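import Mathlib.Geometry.Manifold.IsManifold.Basic
import Literature.AlgebraicGeometry.RealAlgebraic.RealAlgebraicCharts
import Literature.NumberTheory.Transcendental.AnalytificationSeparatedProofs
import HarnessLib

/-!
# The real points of a smooth scheme form a real-analytic manifold (atlas form)

Let `k ⊆ ℝ` be a field and `X` a `k`-scheme smooth of relative dimension `d`. On the set `X(ℝ)`
of real points with its strong topology (`Literature.AlgebraicGeometry.Motives.AlgPoints`) the
real-analytic algebraic charts of `RealAlgebraic/RealAlgebraicCharts`
(`exists_analyticAlgebraicChart`: coordinates regular functions, regular functions real-analytic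
in the chart) form a `C^ω` atlas: the transition maps are regular functions read in a chart. This
file records the resulting **real-analytic manifold structure of `X(ℝ)`** in atlas form —
`exists_chartedSpace_isManifold`: a `ChartedSpace (Fin d → ℝ)` structure on `X(ℝ)` together with
`IsManifold 𝓘(ℝ, ℝᵈ) ω`, all of whose charts have regular coordinates and in all of whose charts
every regular function on every affine open is real-analytic — and, for `X` separated, that `X(ℝ)`
is Hausdorff (`t2Space_algPoints_real`, an instance of the tree's `t2Space_algPoints_holds`).

This is the statement "the nonsingular real points of a variety over `k ⊆ ℝ` form a real-analytic
(indeed Nash) manifold of dimension `d` with algebraic local coordinates" (Bochnak–Coste–Roy,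
*Real Algebraic Geometry*, Prop. 3.3.11 with §3.4; Akbulut–King, *Topology of Real Algebraic
Sets*, II §3); the assembly is word for word that of the complex analytification
(`Literature.NumberTheory.Transcendental.isManifold_chartedSpaceOfCharts`, Serre GAGA §2 n°5
Prop. 2), with `ℝ` for `ℂ`. The structures are packaged existentially (no definitions, no named
facts), in the shape consumed by resolution-of-singularities arguments on real points
(`MathematicalPhysics/QuantumFieldTheory/WilsonPartitionHironakaForm.lean`, binder `hR`).

## References

* J. Bochnak, M. Coste, M.-F. Roy, *Real Algebraic Geometry* (1998), Prop. 3.3.11, §3.4.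
  [BochnakCosteRoy1998]
* S. Akbulut, H. King, *Topology of Real Algebraic Sets* (1992), Ch. II §3. [AkbulutKing1992]
* J.-P. Serre, *Géométrie algébrique et géométrie analytique* (1956), §2 n°5 Prop. 2.
  [SerreGAGA1956]
-/

noncomputable section

universe u

open CategoryTheory AlgebraicGeometry Set
open _root_.Topology
open scoped ContDiff Manifold

namespace Literature.AlgebraicGeometry.RealAlgebraic

open Literature.AlgebraicGeometry.Motives Literature.NumberTheory.Transcendental

variable {k : Type} [Field k] [Algebra k ℝ]

/-- **The real points of a smooth scheme are a real-analytic manifold (atlas form).** For a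
`k`-scheme `X` (`k ⊆ ℝ`) smooth of relative dimension `d` there are a `ChartedSpace (Fin d → ℝ)`
structure on `X(ℝ)` (strong topology) and the `IsManifold 𝓘(ℝ, ℝᵈ) ω` property for it, given by
a chart `chart P` at every real point `P` (`chartAt = chart`, `atlas = range chart`), such that
every chart has regular coordinates on an affine open and every regular function on every affine
open is real-analytic in every chart. (Bochnak–Coste–Roy Prop. 3.3.11; Serre GAGA §2 n°5 Prop. 2
for the formalism.) [cite: BochnakCosteRoy1998, Prop. 3.3.11] -/
theorem exists_chartedSpace_isManifold (X : SchemeOver k) (d : ℕ)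
    [SmoothOfRelativeDimension d X.hom] :
    ∃ (chart : AlgPoints X ℝ → OpenPartialHomeomorph (AlgPoints X ℝ) (Fin d → ℝ))
      (cs : ChartedSpace (Fin d → ℝ) (AlgPoints X ℝ))
      (_ : @IsManifold ℝ _ _ _ _ _ _ 𝓘(ℝ, Fin d → ℝ) ω (AlgPoints X ℝ) _ cs),
      (∀ P, @chartAt (Fin d → ℝ) _ (AlgPoints X ℝ) _ cs P = chart P) ∧
      (@atlas (Fin d → ℝ) _ (AlgPoints X ℝ) _ cs = range chart) ∧
      (∀ P, P ∈ (chart P).source) ∧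
      (∀ P, ∃ (U : X.left.affineOpens) (x : Fin d → Γ(X.left, ↑U)),
        (chart P).source ⊆ {Q | Q.pt ∈ (↑U : X.left.Opens)} ∧
        ∀ Q ∈ (chart P).source, ∀ i, chart P Q i = AlgPoints.evalOrZero ↑U (x i) Q) ∧
      (∀ P (U : X.left.affineOpens) (s : Γ(X.left, ↑U)),
        AnalyticOnNhd ℝ (AlgPoints.evalOrZero ↑U s ∘ (chart P).symm)
          ((chart P).target ∩ (chart P).symm ⁻¹' {Q | Q.pt ∈ (↑U : X.left.Opens)})) := by
  choose chart mem alg hol using fun P₀ : AlgPoints X ℝ => exists_analyticAlgebraicChart X d P₀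
  let cs : ChartedSpace (Fin d → ℝ) (AlgPoints X ℝ) :=
    { atlas := range chart
      chartAt := chart
      mem_chart_source := mem
      chart_mem_atlas := fun P => ⟨P, rfl⟩ }
  letI := cs
  have hM : IsManifold 𝓘(ℝ, Fin d → ℝ) ω (AlgPoints X ℝ) := by
    refine isManifold_of_contDiffOn _ _ _ ?_
    rintro e e' ⟨P, rfl⟩ ⟨P', rfl⟩
    obtain ⟨U', x', hsrc', hx'⟩ := alg P'
    simp only [modelWithCornersSelf_coe, modelWithCornersSelf_coe_symm, Set.range_id,
      Set.inter_univ, Set.preimage_id_eq, id_eq, Function.comp_id, Function.id_comp,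
      OpenPartialHomeomorph.trans_source, OpenPartialHomeomorph.symm_source,
      OpenPartialHomeomorph.coe_trans]
    refine contDiffOn_pi' fun i => ?_
    refine (((hol P U' (x' i)).contDiffOn_of_completeSpace (n := ω)).mono ?_).congr ?_
    · rintro w ⟨hw, hw'⟩
      exact ⟨hw, hsrc' hw'⟩
    · rintro w ⟨-, hw'⟩
      exact hx' _ hw' i
  exact ⟨chart, cs, hM, fun P => rfl, rfl, mem, alg, hol⟩

/-- **Regular functions are real-analytic on the manifold of real points**: with the structures
of `exists_chartedSpace_isManifold`, for every affine open `U` and `s ∈ Γ(X, U)` the function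
`P ↦ s(P)` (extended by `0` off `U(ℝ)`) is `C^ω` at every real point of `U` as a map of
real-analytic manifolds `X(ℝ) → ℝ`. (Bochnak–Coste–Roy §3.2–3.4: regular functions are Nash,
in particular analytic.) [folklore] -/
theorem contMDiffAt_evalOrZero (X : SchemeOver k) (d : ℕ)
    (chart : AlgPoints X ℝ → OpenPartialHomeomorph (AlgPoints X ℝ) (Fin d → ℝ))
    [cs : ChartedSpace (Fin d → ℝ) (AlgPoints X ℝ)]
    (hchart : ∀ P, chartAt (Fin d → ℝ) P = chart P)
    (mem : ∀ P, P ∈ (chart P).source)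
    (hol : ∀ P (U : X.left.affineOpens) (s : Γ(X.left, ↑U)),
      AnalyticOnNhd ℝ (AlgPoints.evalOrZero ↑U s ∘ (chart P).symm)
        ((chart P).target ∩ (chart P).symm ⁻¹' {Q | Q.pt ∈ (↑U : X.left.Opens)}))
    (U : X.left.affineOpens) (s : Γ(X.left, ↑U)) {P : AlgPoints X ℝ}
    (hP : P.pt ∈ (↑U : X.left.Opens)) :
    ContMDiffAt 𝓘(ℝ, Fin d → ℝ) 𝓘(ℝ, ℝ) ω (AlgPoints.evalOrZero ↑U s) P := by
  rw [contMDiffAt_iff]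
  refine ⟨(AlgPoints.continuousOn_evalOrZero _ s).continuousAt
    ((AlgPoints.isOpen_setOf_pt_mem _).mem_nhds hP), ?_⟩
  simp only [extChartAt, OpenPartialHomeomorph.extend, modelWithCornersSelf_partialEquiv,
    PartialEquiv.trans_refl, modelWithCornersSelf_coe, Set.range_id,
    OpenPartialHomeomorph.coe_toPartialEquiv_symm, OpenPartialHomeomorph.coe_toPartialEquiv,
    hchart, chartAt_self_eq, OpenPartialHomeomorph.refl_apply, Function.id_comp]
  refine ContDiffAt.contDiffWithinAt ?_
  have hopen : IsOpen ((chart P).target ∩ (chart P).symm ⁻¹' {Q | Q.pt ∈ (↑U : X.left.Opens)}) :=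
    (chart P).isOpen_inter_preimage_symm (AlgPoints.isOpen_setOf_pt_mem _)
  have hmem : chart P P ∈ (chart P).target ∩ (chart P).symm ⁻¹' {Q | Q.pt ∈ (↑U : X.left.Opens)} :=
    ⟨(chart P).map_source (mem P), by
      simp only [Set.mem_preimage, Set.mem_setOf_eq, (chart P).left_inv (mem P)]; exact hP⟩
  exact ((hol P U s).contDiffOn_of_completeSpace (n := ω)).contDiffAt (hopen.mem_nhds hmem)

/-- **`X(ℝ)` is Hausdorff for `X` separated over `k ⊆ ℝ`** (the real instance of the tree's
`t2Space_algPoints_holds`; Mumford, Red Book I.10 Thm. 1; Conrad, Prop. 2.1). [folklore] -/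
theorem t2Space_algPoints_real (X : SchemeOver k) [IsSeparated X.hom] : T2Space (AlgPoints X ℝ) :=
  t2Space_algPoints_holds X ℝ

end Literature.AlgebraicGeometry.RealAlgebraic

end
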